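import Mathlib
import HarnessLib
import Literature.Probability.MarkovChains.TotalVariation
import Summits.Ventures.LatticeQCDFlow.Exactness.TemperedTransitions
import Summits.Ventures.LatticeQCDFlow.Exactness.CrooksReversal
import Summits.Ventures.LatticeQCDFlow.Exactness.JarzynskiFinite
import Summits.Ventures.LatticeQCDFlow.Scaling.StochasticFlows
import Summits.Ventures.LatticeQCDFlow.Scaling.Bhattacharyya

/-!
# The acceptance functional of tempered transitions (palindromic NCMC): `acc = 1 − TV(F, F ∘ swap)`

HONEST FRAMING: exact (Metropolis-corrected) sampling algorithms for lattice gauge theory;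
figures of merit are autocorrelation/cost numbers at stated couplings and volumes; no
continuum-physics claim.

Venture `LatticeQCDFlow` (cell pub-lqcd), topic `Exactness`; FANOUT row 8 (`s0-cpn-nemc`, GEN-8).
NEW WORK of the cell (elementary finite sums), not a published result; nothing is cited as a fact.
Named only: R. M. Neal, Statistics and Computing 6 (1996) 353 (tempered transitions); J. P.
Nilmeier, G. E. Crooks, D. D. L. Minh, J. D. Chodera, PNAS 108 (2011) E1009 (NCMC with a
symmetric protocol: acceptance `min 1 e^{-W}`).  This is the ACCEPTANCE side of row 13's
`Exactness/TemperedTransitions.lean` (the `correction = tempered-transitions` mode of `latflow-snf`: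
from the current TARGET state go up the protocol to the open / defect ensemble and back down,
accept the round trip with `min 1 e^{-W}`), whose EXACTNESS (`temperedKernel_isStationary`) is
already in the tree; companions: `Exactness/NCMCAcceptance.lean` (one-way switch) and
`Exactness/TemperedTransitionsAcceptanceBounds.lean` (caps and floors of the functional below).

## Content (vocabulary of `TemperedTransitions.lean`: `upProb`, `downProb`, `roundTripWork`,
`temperedMove`; nothing re-declared)

* `roundTripLaw S T Tadj (u, d) = [u N = d N] · gibbsLaw (S 0) (u 0) · upProb T u · downProb Tadj d`
  — the law of the proposed round trip when the chain is stationary; `sum_roundTripLaw` (a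
  probability law for stochastic up/down kernels: `sum_terminal_downProb`, `sum_pathLaw`);
  **`roundTripLaw_swap`** — TIME REVERSAL: `F(d, u) = F(u, d) · e^{-W(u, d)}` (`roundTrip_pathwise`).
* `ttAccRate S T Tadj = Σ_x gibbsLaw (S 0) x · Σ_x' temperedMove S T Tadj x x'` — the stationary
  mean acceptance of Neal's kernel; `ttAccRate_eq_sum_mul_min` (`= Σ_{(u,d)} F · min(1, e^{-W})`),
  `ttAccRate_eq_sum_min`, **`ttAccRate_eq_one_sub_tvDist`** — `acc_TT = Σ min(F, F∘swap)
  = 1 − ‖F − F∘swap‖_TV` EXACTLY: the acceptance is the overlap of the round-trip ensemble with its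
  own time reversal, for ANY number of levels, interpolating actions and stochastic up/down kernels
  mutually reversible level by level.
* **`ttAccRate_eq_prob_add_prob`** — `acc_TT = F(W ≤ 0) + F(W < 0)` (`= 2·F(W < 0) + F(W = 0)`,
  Nilmeier et al.'s symmetric-protocol formula).
* `ttAccRate_mem_Icc`; **`ttAccRate_eq_one_iff`** — with positive kernels, sure acceptance iff EVERY
  round trip meeting at the top is work-free.

Reading (design, not typed): unlike the one-way switch (`NCMCAcceptanceBounds.lean`:
`Σ min ≤ 1 − TV(π₁^ext, π₀^ext)` for a frozen exterior), a round trip that freezes the exterior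
carries NO exterior penalty in its acceptance — start and candidate share the exterior, which is
already target-distributed — and correspondingly never refreshes it; the exterior is moved only by
the interleaved target updates.  Gaussian dictionary (`W ∼ N(s²/2, s²)` under `F`):
`acc_TT = 2Φ(−s/2)`; if the two legs dissipate independently like one-way switches of variance `σ²`
each (`s² = 2σ²`) this is `2Φ(−σ/√2)`, the path-IMH value, below the one-way switch's `2Φ(−σ/2)`.
-/

namespace Summit.Ventures.LatticeQCDFlow.Exactness

open Finset
open Literature.Probability.MarkovChains
open Summit.Ventures.LatticeQCDFlow.Theory2 (gibbsLaw_pos sum_gibbsLaw partitionFn_pos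
  sum_min_eq_one_sub_tvDist)

variable {X : Type*} [Fintype X] [DecidableEq X] {N : ℕ}

/-! ## The round-trip law and its time reversal -/

/-- Law of the round trip `(u, d)` proposed by a tempered transition when the chain is in
equilibrium: start `u 0 ∼ e^{-S 0}/Z 0`, up-path `u`, down-path `d` from the top `d N = u N`
(pairs not meeting at the top have weight `0`). -/
noncomputable def roundTripLaw (S : Fin (N + 1) → X → ℝ) (T Tadj : Fin N → X → X → ℝ)
    (z : (Fin (N + 1) → X) × (Fin (N + 1) → X)) : ℝ :=
  if z.1 (Fin.last N) = z.2 (Fin.last N) then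
    gibbsLaw (S 0) (z.1 0) * upProb T z.1 * downProb Tadj z.2 else 0

/-- **Stationary mean acceptance of tempered transitions**: `Σ_x π_0(x) Σ_x' temperedMove x x'`,
the equilibrium probability that Neal's round trip is accepted. -/
noncomputable def ttAccRate (S : Fin (N + 1) → X → ℝ) (T Tadj : Fin N → X → X → ℝ) : ℝ :=
  ∑ x, gibbsLaw (S 0) x * ∑ x', temperedMove S T Tadj x x'

/-- The round-trip law is non-negative for non-negative kernels. -/
theorem roundTripLaw_nonneg [Nonempty X] (S : Fin (N + 1) → X → ℝ) {T Tadj : Fin N → X → X → ℝ}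
    (hT : ∀ i a b, 0 ≤ T i a b) (hTadj : ∀ i a b, 0 ≤ Tadj i a b)
    (z : (Fin (N + 1) → X) × (Fin (N + 1) → X)) : 0 ≤ roundTripLaw S T Tadj z := by
  unfold roundTripLaw
  split_ifs
  · exact mul_nonneg (mul_nonneg (gibbsLaw_pos (S 0) _).le (upProb_nonneg hT _))
      (downProb_nonneg hTadj _)
  · exact le_rfl

/-- With positive kernels the round-trip law is positive exactly on the pairs meeting at the top. -/
theorem roundTripLaw_pos [Nonempty X] (S : Fin (N + 1) → X → ℝ) {T Tadj : Fin N → X → X → ℝ}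
    (hT : ∀ i a b, 0 < T i a b) (hTadj : ∀ i a b, 0 < Tadj i a b)
    {z : (Fin (N + 1) → X) × (Fin (N + 1) → X)} (hz : z.1 (Fin.last N) = z.2 (Fin.last N)) :
    0 < roundTripLaw S T Tadj z := by
  unfold roundTripLaw
  rw [if_pos hz]
  exact mul_pos (mul_pos (gibbsLaw_pos (S 0) _) (prod_pos fun i _ => hT i _ _))
    (prod_pos fun i _ => hTadj i _ _)

/-- **The round-trip law is a probability law** (stochastic up- and down-kernels): the down-paths
from a fixed top sum to one (`sum_terminal_downProb`), then the up-paths from equilibrium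
(`sum_pathLaw`; `upProb T = transProb T`). -/
theorem sum_roundTripLaw [Nonempty X] (S : Fin (N + 1) → X → ℝ) {T Tadj : Fin N → X → X → ℝ}
    (hTrow : ∀ i a, ∑ b, T i a b = 1) (hTadjrow : ∀ i b, ∑ a, Tadj i b a = 1) :
    ∑ z, roundTripLaw S T Tadj z = 1 := by
  rw [Fintype.sum_prod_type]
  simp only [roundTripLaw]
  have hinner : ∀ u : Fin (N + 1) → X,
      ∑ d : Fin (N + 1) → X, (if u (Fin.last N) = d (Fin.last N) then
        gibbsLaw (S 0) (u 0) * upProb T u * downProb Tadj d else 0) =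
      gibbsLaw (S 0) (u 0) * upProb T u := by
    intro u
    have h := sum_terminal_downProb (fun y => if u (Fin.last N) = y then (1 : ℝ) else 0) Tadj hTadjrow
    rw [sum_ite_eq univ (u (Fin.last N)), if_pos (mem_univ _)] at h
    calc ∑ d : Fin (N + 1) → X, (if u (Fin.last N) = d (Fin.last N) then
            gibbsLaw (S 0) (u 0) * upProb T u * downProb Tadj d else 0)
        = ∑ d : Fin (N + 1) → X, gibbsLaw (S 0) (u 0) * upProb T u *
            ((if u (Fin.last N) = d (Fin.last N) then (1 : ℝ) else 0) * downProb Tadj d) := by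
          refine sum_congr rfl fun d _ => ?_
          split_ifs <;> ring
      _ = gibbsLaw (S 0) (u 0) * upProb T u := by rw [← mul_sum, h, mul_one]
  simp only [hinner]
  have h2 := sum_pathLaw (gibbsLaw (S 0)) T hTrow
  simp only [pathLaw] at h2
  rw [show (∑ u : Fin (N + 1) → X, gibbsLaw (S 0) (u 0) * upProb T u) =
      ∑ u : Fin (N + 1) → X, gibbsLaw (S 0) (u 0) * transProb T u from rfl, h2, sum_gibbsLaw]

/-- **Time reversal of the round trip.**  For up/down kernels mutually reversible level by level,
`F(d, u) = F(u, d) · e^{-W(u, d)}`: the reversed round trip is the same pair with the roles of the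
paths swapped, reweighted by the Metropolis factor (`roundTrip_pathwise`; all partition functions
cancel). -/
theorem roundTripLaw_swap [Nonempty X] (S : Fin (N + 1) → X → ℝ) {T Tadj : Fin N → X → X → ℝ}
    (hrev : ∀ i : Fin N, MutuallyReversible (fun x => Real.exp (-S i.succ x)) (T i) (Tadj i))
    (z : (Fin (N + 1) → X) × (Fin (N + 1) → X)) :
    roundTripLaw S T Tadj z.swap = roundTripLaw S T Tadj z * Real.exp (-roundTripWork S z.1 z.2) := by
  obtain ⟨u, d⟩ := z
  simp only [roundTripLaw, Prod.swap_prod_mk]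
  by_cases htop : u (Fin.last N) = d (Fin.last N)
  · rw [if_pos htop, if_pos htop.symm]
    have key := roundTrip_pathwise S T Tadj hrev u d htop
    have hZ : partitionFn (S 0) ≠ 0 := (partitionFn_pos (S 0)).ne'
    simp only [gibbsLaw]
    calc Real.exp (-S 0 (d 0)) / partitionFn (S 0) * upProb T d * downProb Tadj u
        = (Real.exp (-S 0 (d 0)) * upProb T d * downProb Tadj u) / partitionFn (S 0) := by ring
      _ = (Real.exp (-S 0 (u 0)) * upProb T u * downProb Tadj d *
            Real.exp (-roundTripWork S u d)) / partitionFn (S 0) := by rw [key]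
      _ = Real.exp (-S 0 (u 0)) / partitionFn (S 0) * upProb T u * downProb Tadj d *
            Real.exp (-roundTripWork S u d) := by ring
  · have htop' : ¬d (Fin.last N) = u (Fin.last N) := fun h => htop h.symm
    rw [if_neg htop', if_neg htop, zero_mul]

/-- The swapped round-trip law is a probability law too (re-indexing by `Prod.swap`). -/
theorem sum_roundTripLaw_swap [Nonempty X] (S : Fin (N + 1) → X → ℝ) {T Tadj : Fin N → X → X → ℝ}
    (hTrow : ∀ i a, ∑ b, T i a b = 1) (hTadjrow : ∀ i b, ∑ a, Tadj i b a = 1) :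
    ∑ z : (Fin (N + 1) → X) × (Fin (N + 1) → X), roundTripLaw S T Tadj z.swap = 1 := by
  rw [← sum_roundTripLaw S hTrow hTadjrow]
  exact Fintype.sum_equiv (Equiv.prodComm _ _) _ _ (fun z => rfl)

/-! ## The acceptance functional: kernel form = round-trip form -/

/-- `acc_TT = Σ_{(u,d)} F(u,d) · min(1, e^{-W(u,d)})` — unfolding `temperedMove` and summing out the
end-point constraints. -/
theorem ttAccRate_eq_sum_mul_min [Nonempty X] (S : Fin (N + 1) → X → ℝ)
    (T Tadj : Fin N → X → X → ℝ) :
    ttAccRate S T Tadj =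
      ∑ z, roundTripLaw S T Tadj z * min 1 (Real.exp (-roundTripWork S z.1 z.2)) := by
  rw [Fintype.sum_prod_type]
  unfold ttAccRate temperedMove roundTripLaw
  -- push the equilibrium weight inside and reorder the four sums
  have step : ∀ x : X,
      gibbsLaw (S 0) x * ∑ x', ∑ u : Fin (N + 1) → X, ∑ d : Fin (N + 1) → X,
        (if u 0 = x ∧ d 0 = x' ∧ u (Fin.last N) = d (Fin.last N) then
          upProb T u * downProb Tadj d * min 1 (Real.exp (-roundTripWork S u d)) else 0) =
      ∑ u : Fin (N + 1) → X, ∑ d : Fin (N + 1) → X, ∑ x',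
        (if u 0 = x ∧ d 0 = x' ∧ u (Fin.last N) = d (Fin.last N) then
          gibbsLaw (S 0) x * (upProb T u * downProb Tadj d *
            min 1 (Real.exp (-roundTripWork S u d))) else 0) := by
    intro x
    rw [mul_sum]
    simp_rw [mul_sum, mul_ite, mul_zero]
    rw [sum_comm]
    exact sum_congr rfl fun u _ => sum_comm
  simp_rw [step]
  rw [sum_comm]
  refine sum_congr rfl fun u _ => ?_
  rw [sum_comm]
  refine sum_congr rfl fun d _ => ?_
  -- evaluate the two Kronecker sums
  rw [sum_eq_single (u 0)]
  · rw [sum_eq_single (d 0)]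
    · by_cases htop : u (Fin.last N) = d (Fin.last N)
      · rw [if_pos ⟨rfl, rfl, htop⟩, if_pos htop]; ring
      · rw [if_neg (fun h => htop h.2.2), if_neg htop, zero_mul]
    · intro x' _ hx'
      rw [if_neg]
      rintro ⟨_, h, _⟩
      exact hx' h.symm
    · intro h; exact absurd (mem_univ _) h
  · intro x _ hx
    refine sum_eq_zero fun x' _ => ?_
    rw [if_neg]
    rintro ⟨h, _⟩
    exact hx h.symm
  · intro h; exact absurd (mem_univ _) h

/-- Termwise: `F(z) · min(1, e^{-W(z)}) = min(F(z), F(z.swap))`. -/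
theorem roundTripLaw_mul_min_eq [Nonempty X] (S : Fin (N + 1) → X → ℝ) {T Tadj : Fin N → X → X → ℝ}
    (hT : ∀ i a b, 0 ≤ T i a b) (hTadj : ∀ i a b, 0 ≤ Tadj i a b)
    (hrev : ∀ i : Fin N, MutuallyReversible (fun x => Real.exp (-S i.succ x)) (T i) (Tadj i))
    (z : (Fin (N + 1) → X) × (Fin (N + 1) → X)) :
    roundTripLaw S T Tadj z * min 1 (Real.exp (-roundTripWork S z.1 z.2)) =
      min (roundTripLaw S T Tadj z) (roundTripLaw S T Tadj z.swap) := by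
  rw [mul_min_of_nonneg _ _ (roundTripLaw_nonneg S hT hTadj z), mul_one, ← roundTripLaw_swap S hrev]

/-- `acc_TT = Σ_z min(F(z), F(z.swap))`. -/
theorem ttAccRate_eq_sum_min [Nonempty X] (S : Fin (N + 1) → X → ℝ) {T Tadj : Fin N → X → X → ℝ}
    (hT : ∀ i a b, 0 ≤ T i a b) (hTadj : ∀ i a b, 0 ≤ Tadj i a b)
    (hrev : ∀ i : Fin N, MutuallyReversible (fun x => Real.exp (-S i.succ x)) (T i) (Tadj i)) :
    ttAccRate S T Tadj = ∑ z, min (roundTripLaw S T Tadj z) (roundTripLaw S T Tadj z.swap) := by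
  rw [ttAccRate_eq_sum_mul_min]
  exact sum_congr rfl fun z _ => roundTripLaw_mul_min_eq S hT hTadj hrev z

/-- **THE TEMPERED-TRANSITIONS ACCEPTANCE IDENTITY.**  `acc_TT = 1 − ‖F − F∘swap‖_TV`: the
stationary acceptance of Neal's round trip is the overlap of the round-trip ensemble with its time
reversal — for ANY number of levels, interpolating actions, and stochastic up/down kernels mutually
reversible level by level. -/
theorem ttAccRate_eq_one_sub_tvDist [Nonempty X] (S : Fin (N + 1) → X → ℝ)
    {T Tadj : Fin N → X → X → ℝ} (hT : ∀ i a b, 0 ≤ T i a b) (hTadj : ∀ i a b, 0 ≤ Tadj i a b)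
    (hTrow : ∀ i a, ∑ b, T i a b = 1) (hTadjrow : ∀ i b, ∑ a, Tadj i b a = 1)
    (hrev : ∀ i : Fin N, MutuallyReversible (fun x => Real.exp (-S i.succ x)) (T i) (Tadj i)) :
    ttAccRate S T Tadj =
      1 - tvDist (roundTripLaw S T Tadj) (fun z => roundTripLaw S T Tadj z.swap) := by
  rw [ttAccRate_eq_sum_min S hT hTadj hrev]
  exact sum_min_eq_one_sub_tvDist (sum_roundTripLaw S hTrow hTadjrow)
    (sum_roundTripLaw_swap S hTrow hTadjrow)

/-! ## Nilmeier's form: probabilities of non-positive round-trip work -/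

/-- **`acc_TT = F(W ≤ 0) + F(W < 0)`** (`= 2 F(W < 0) + F(W = 0)`): termwise `min(F(z), F(z) e^{-W(z)})`
is `F(z)` where `W ≤ 0` and `F(z.swap)` where `W > 0`, and re-indexing the latter by the swap turns
`W(z) > 0` into `W(z) < 0` (`roundTripWork_swap`). -/
theorem ttAccRate_eq_prob_add_prob [Nonempty X] (S : Fin (N + 1) → X → ℝ)
    {T Tadj : Fin N → X → X → ℝ} (hT : ∀ i a b, 0 ≤ T i a b) (hTadj : ∀ i a b, 0 ≤ Tadj i a b)
    (hrev : ∀ i : Fin N, MutuallyReversible (fun x => Real.exp (-S i.succ x)) (T i) (Tadj i)) :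
    ttAccRate S T Tadj =
      (∑ z ∈ univ.filter (fun z : (Fin (N + 1) → X) × (Fin (N + 1) → X) =>
          roundTripWork S z.1 z.2 ≤ 0), roundTripLaw S T Tadj z) +
        ∑ z ∈ univ.filter (fun z : (Fin (N + 1) → X) × (Fin (N + 1) → X) =>
          roundTripWork S z.1 z.2 < 0), roundTripLaw S T Tadj z := by
  rw [ttAccRate_eq_sum_min S hT hTadj hrev]
  have key : ∀ z : (Fin (N + 1) → X) × (Fin (N + 1) → X),
      min (roundTripLaw S T Tadj z) (roundTripLaw S T Tadj z.swap) =
        if roundTripWork S z.1 z.2 ≤ 0 then roundTripLaw S T Tadj z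
        else roundTripLaw S T Tadj z.swap := by
    intro z
    have hF := roundTripLaw_nonneg S hT hTadj z
    rw [roundTripLaw_swap S hrev z]
    split_ifs with h
    · refine min_eq_left ?_
      calc roundTripLaw S T Tadj z = roundTripLaw S T Tadj z * 1 := (mul_one _).symm
        _ ≤ roundTripLaw S T Tadj z * Real.exp (-roundTripWork S z.1 z.2) :=
            mul_le_mul_of_nonneg_left (Real.one_le_exp (by linarith)) hF
    · refine min_eq_right ?_
      calc roundTripLaw S T Tadj z * Real.exp (-roundTripWork S z.1 z.2)
          ≤ roundTripLaw S T Tadj z * 1 :=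
            mul_le_mul_of_nonneg_left (Real.exp_le_one_iff.mpr (by linarith [not_le.mp h])) hF
        _ = roundTripLaw S T Tadj z := mul_one _
  rw [sum_congr rfl fun z _ => key z, sum_ite]
  congr 1
  -- re-index the rejected-side sum by the swap
  have hswap : (∑ z ∈ univ.filter (fun z : (Fin (N + 1) → X) × (Fin (N + 1) → X) =>
        ¬roundTripWork S z.1 z.2 ≤ 0), roundTripLaw S T Tadj z.swap) =
      ∑ z : (Fin (N + 1) → X) × (Fin (N + 1) → X),
        (if roundTripWork S z.swap.1 z.swap.2 < 0 then roundTripLaw S T Tadj z.swap else 0) := by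
    rw [sum_filter]
    refine sum_congr rfl fun z _ => ?_
    obtain ⟨u, d⟩ := z
    simp only [Prod.swap_prod_mk, roundTripWork_swap S u d, not_le, neg_lt_zero]
  rw [hswap, sum_filter]
  exact Fintype.sum_equiv (Equiv.prodComm _ _) _ _ (fun z => rfl)

/-! ## Sure acceptance iff every round trip is work-free -/

/-- `0 ≤ acc_TT ≤ 1`. -/
theorem ttAccRate_mem_Icc [Nonempty X] (S : Fin (N + 1) → X → ℝ) {T Tadj : Fin N → X → X → ℝ}
    (hT : ∀ i a b, 0 ≤ T i a b) (hTadj : ∀ i a b, 0 ≤ Tadj i a b)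
    (hTrow : ∀ i a, ∑ b, T i a b = 1) (hTadjrow : ∀ i b, ∑ a, Tadj i b a = 1)
    (hrev : ∀ i : Fin N, MutuallyReversible (fun x => Real.exp (-S i.succ x)) (T i) (Tadj i)) :
    ttAccRate S T Tadj ∈ Set.Icc (0 : ℝ) 1 := by
  rw [ttAccRate_eq_one_sub_tvDist S hT hTadj hTrow hTadjrow hrev]
  have h0 := tvDist_nonneg (roundTripLaw S T Tadj) (fun z => roundTripLaw S T Tadj z.swap)
  have h1 := tvDist_le_one (roundTripLaw_nonneg S hT hTadj)
    (fun z => roundTripLaw_nonneg S hT hTadj z.swap)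
    (sum_roundTripLaw S hTrow hTadjrow) (sum_roundTripLaw_swap S hTrow hTadjrow)
  exact ⟨by linarith, by linarith⟩

/-- **Sure acceptance iff no round-trip work.**  With positive stochastic kernels, `acc_TT = 1` iff
`W(u, d) = 0` for EVERY pair of paths meeting at the top. -/
theorem ttAccRate_eq_one_iff [Nonempty X] (S : Fin (N + 1) → X → ℝ) {T Tadj : Fin N → X → X → ℝ}
    (hT : ∀ i a b, 0 < T i a b) (hTadj : ∀ i a b, 0 < Tadj i a b)
    (hTrow : ∀ i a, ∑ b, T i a b = 1) (hTadjrow : ∀ i b, ∑ a, Tadj i b a = 1)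
    (hrev : ∀ i : Fin N, MutuallyReversible (fun x => Real.exp (-S i.succ x)) (T i) (Tadj i)) :
    ttAccRate S T Tadj = 1 ↔
      ∀ u d : Fin (N + 1) → X, u (Fin.last N) = d (Fin.last N) → roundTripWork S u d = 0 := by
  rw [ttAccRate_eq_one_sub_tvDist S (fun i a b => (hT i a b).le) (fun i a b => (hTadj i a b).le)
    hTrow hTadjrow hrev, sub_eq_self, tvDist_eq_zero_iff]
  constructor
  · intro h u d htop
    have hz : roundTripLaw S T Tadj (u, d) = roundTripLaw S T Tadj (u, d).swap := congrFun h (u, d)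
    rw [roundTripLaw_swap S hrev (u, d)] at hz
    have hF := roundTripLaw_pos S hT hTadj (z := (u, d)) htop
    have hexp : Real.exp (-roundTripWork S u d) = 1 :=
      mul_left_cancel₀ hF.ne' (hz.symm.trans (mul_one _).symm)
    have := (Real.exp_eq_one_iff _).mp hexp
    linarith
  · intro h
    funext z
    rw [roundTripLaw_swap S hrev z]
    by_cases htop : z.1 (Fin.last N) = z.2 (Fin.last N)
    · rw [h z.1 z.2 htop, neg_zero, Real.exp_zero, mul_one]
    · have h0 : roundTripLaw S T Tadj z = 0 := by
        unfold roundTripLaw; rw [if_neg htop]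
      rw [h0, zero_mul]

end Summit.Ventures.LatticeQCDFlow.Exactness
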